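import Literature.NumberTheory.EllipticCurves.ModularFunctionFieldPointValues
import HarnessLib

/-!
# The eight coordinate functions of `X₀(N)` (Eisenstein coordinates, `E₄E₄(Nτ)²/Δ` and `j`)

Topic `NumberTheory/EllipticCurves` (shared definitions for the "canonical model of `X₀(N)` at CM
points" chain).  The eight weight-`12` modular forms `coordForm N i` on `Γ₀(N)` —
`E₄³, E₆², E₄²E₄(Nτ), E₆E₆(Nτ), E₄(Nτ)³, E₆(Nτ)²` (the `eisMonomial`s of
`ModularCurveEisensteinCoordinates`), `E₄E₄(Nτ)²` and `E₄³` — the weight-zero modular functions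
`coordFn N i = coordForm N i / Δ ∈ K_N` they define (`coordFn N 7 = j`), and their values
`coordVal N i τ = coordForm N i τ / Δ(τ)`; the `coordFn` are holomorphic on `ℍ` with value `coordVal`
at `P_τ` (`coordFn_mem_pointPlace`, `pointValuation_coordFn_sub_lt_one`).  All eight have
`q`-expansions with rational coefficients (`ModularCurveCoordinateRationality`), the six Eisenstein
coordinates separate the points of `Y₀(N)` (`ModularCurveEisensteinCoordinates`), and the algebra
they generate contains a uniformizer at every point (`ModularCurveLocalRingsAtPoints`).

Everything is proved; no named facts are introduced.

## References

* F. Diamond, J. Shurman, *A First Course in Modular Forms*, GTM 228, 2005, §1.2, §3.2, §7.5.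
  [DiamondShurman2005]
-/

noncomputable section

open scoped MatrixGroups ModularForm Modular Classical IntermediateField WithZero
open CongruenceSubgroup Matrix.SpecialLinearGroup ModularGroup ModularForm EisensteinSeries
open UpperHalfPlane hiding I
open Literature.NumberTheory.DiophantineGeometry
open Literature.NumberTheory.DiophantineGeometry.AlgFunctionField

namespace Literature.NumberTheory.EllipticCurves.ModularForms

variable {N : ℕ} [NeZero N]

/-! ### The eight coordinate functions -/

variable (N) in
/-- The eight weight-`12` numerators: the six monomials of `ModularCurveEisensteinCoordinates`,
`E₄E₄(Nτ)²` and `E₄³` (so that `coordFn N 7 = j`). [folklore] -/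
def coordForm : Fin 8 → ModularForm (Gamma0 N) 12
  | 0 => eisMonomial N 0
  | 1 => eisMonomial N 1
  | 2 => eisMonomial N 2
  | 3 => eisMonomial N 3
  | 4 => eisMonomial N 4
  | 5 => eisMonomial N 5
  | 6 => ((ofLevelOne (Gamma0 N) E₄).mul ((scaleN N E₄).mul (scaleN N E₄))).mcast (by norm_num)
  | 7 => ofLevelOne (Gamma0 N) E₄cube

variable (N) in
/-- **The coordinate functions** `vᵢ = mᵢ/Δ ∈ K_N`. [folklore] -/
def coordFn (i : Fin 8) : modularFunctionField N :=
  mkFn (coordForm N i) (deltaN N) ofLevelOne_delta_ne_zero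

variable (N) in
/-- The values `vᵢ(τ) = mᵢ(τ)/Δ(τ)` of the coordinate functions. [folklore] -/
def coordVal (i : Fin 8) (τ : ℍ) : ℂ :=
  coordForm N i τ / ModularForm.discriminant τ

/-- The first six coordinates are the Eisenstein coordinates. [folklore] -/
theorem coordVal_castLE (i : Fin 6) (τ : ℍ) :
    coordVal N (Fin.castLE (by norm_num) i) τ = eisCoord N i τ := by
  fin_cases i <;> rfl

/-- The first six coordinate functions are those of `ModularCurveEisensteinCoordinates`. [folklore] -/
theorem coordFn_castLE (i : Fin 6) : coordFn N (Fin.castLE (by norm_num) i) = eisCoordFn N i := by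
  fin_cases i <;> rfl

/-- `v₇ = j`. [folklore] -/
theorem coordFn_seven : coordFn N 7 = kleinJK N := Subtype.ext rfl

/-- The coordinate functions are holomorphic on `ℍ`. [folklore] -/
theorem coordFn_mem_pointPlace (i : Fin 8) (τ : ℍ) :
    coordFn N i ∈ (pointPlace (N := N) τ).toValuationSubring :=
  mkFn_deltaN_mem_pointPlace _ τ

/-- `vᵢ(τ)` is the value of `vᵢ` at `P_τ`: `v_τ(vᵢ − vᵢ(τ)) < 1`. [folklore] -/
theorem pointValuation_coordFn_sub_lt_one (i : Fin 8) (τ : ℍ) :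
    pointValuation (N := N) τ (coordFn N i - algebraMap ℂ (modularFunctionField N) (coordVal N i τ)) < 1 :=
  pointValuation_mkFn_deltaN_sub_lt_one _ τ

end Literature.NumberTheory.EllipticCurves.ModularForms

end
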